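import Literature.AlgebraicGeometry.Resolution.InseparableLocalUniformizationDescent
import Literature.AlgebraicGeometry.Resolution.InseparableLocalUniformizationHeightZero
import Literature.AlgebraicGeometry.Resolution.NormalizationOfVarietiesProofs
import Literature.AlgebraicGeometry.Resolution.TranscendenceDefect
import Mathlib.FieldTheory.RatFunc.AsPolynomial
import HarnessLib

/-!
# Inseparable local uniformization: the induction on the transcendence defect (Thm. 4.1.1)

Topic: `Literature/AlgebraicGeometry/Resolution`. One printed layer below
`InseparableLocalUniformizationDescent.lean` in the vendoring of M. Temkin, *Inseparable local
uniformization*, J. Algebra 373 (2013) 65–119 = arXiv:0804.1554v3 (all numbers and pages are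
those of this version). After `InseparableLocalUniformizationProofs.lean` the frontier of the
named fact `Temkin2013` (Thm. 1.3.2) is {`Temkin2013Descent` = Thm. 4.1.1 (`n = 1`, descent
form, logarithmic data dropped), `Temkin2013HeightStepOfDescent` = §4.2}. The printed proof of
Thm. 4.1.1 (pp. 47–50) is an induction on the **transcendence defect** `D_{K/k}` (Step 0,
p. 47), whose vocabulary (`E`, `F`, `D`, Abhyankar's inequality — PROVED) is
`TranscendenceDefect.lean`. This file performs that induction:

* `Temkin2013DescentFor k K O` — the assertion of Thm. 4.1.1 (`n = 1`, non-log) for ONE valued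
  field `(K, O)` over `k`, verbatim the body of `Temkin2013Descent` (`temkin2013Descent_iff`
  is `Iff.rfl`).
* `Temkin2013DescentDefectLE d` — Thm. 4.1.1 (`n = 1`, non-log) for all finitely generated
  `K/k`, `O ⊇ k` of height `≤ 1` AND transcendence defect `D_{K/k} ≤ d`.
* `Temkin2013DescentAbhyankar` — NAMED FACT, the induction base: Thm. 4.1.1 (`n = 1`, non-log)
  for `D_{K/k} = 0`, i.e. for **Abhyankar valuations** (Step 0, p. 47: "The induction base
  `D_{K/k} = 0` corresponds to the case of Abhyankar valuations, which will be established in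
  §5: it is a particular case of Theorem 5.5.2"; Thm. 5.5.2, p. 60, is the simultaneous local
  LOG uniformization of Abhyankar valuations, proved by toroidal/logarithmic geometry in §5).
* `Temkin2013DescentDefectStep` — NAMED FACT, the induction step: level `d` implies level
  `d + 1` (Steps 1–4, pp. 47–50: a valued subfield `k̄ ⊆ K` with `tr.deg._{k̄}(K) = 1`, `K/k̄`
  transcendentally immediate and `D_{k̄/k} = D - 1` (Remark 2.1.2); uniformization of the curve
  `Nr_K(X ×_Y S)` over `S = Spec k̄°` by Thm. 3.3.1; smooth-equivalence of centres, Prop. 2.3.8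
  and Lemma 2.8.4; the induction hypothesis applied to `Y`, `k̄°` and `m₁°` — in the descent
  form, Remark 4.1.3 —; Lemma 2.8.5). Like `Temkin2013HeightStepOfDescent` it is rendered as
  the implication those steps prove, packaging Thm. 3.3.1 (which rests on Berkovich-analytic
  geometry and the stable modification theorem) and the smooth-equivalence lemmas, whose
  notions Mathlib lacks.
* PROVED: `Temkin2013DescentDefectLE.of_step` (the induction), `Temkin2013Descent.of_defect :
  Temkin2013DescentAbhyankar → Temkin2013DescentDefectStep → Temkin2013Descent` (every finitely
  generated valued `K/k` has a finite transcendence defect — `transcendenceDefect` is a natural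
  number by Abhyankar's inequality), the converse sanity checks `Temkin2013Descent.abhyankar`,
  `Temkin2013Descent.defectStep`, `temkin2013Descent_iff_defectStep`, and the assembled
  **new frontier** `Temkin2013.of_defect_frontier :
  Temkin2013DescentAbhyankar → Temkin2013DescentDefectStep → Temkin2013HeightStepOfDescent →
  Temkin2013` (also for `Temkin2013Relative` and `Temkin2013HeightLeOne`).
* PROVED, unconditionally: `temkin2013DescentFor_top` — the descent theorem in height `0`
  (trivial valuation; then every finite extension of valued fields is trivially valued too):
  the first sentence of the proof of Thm. 4.1.1 (p. 47: "the case of valued fields of height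
  zero reduces to the classical theorem on the existence of a separating transcendence basis"),
  via `exists_purelyInseparable_isSeparablyGenerated` (`SeparatingTranscendenceBasis.lean`)
  applied to `K₁/k`, E. Noether's finiteness of the integral closure
  (`NoetherFiniteIntegralClosure_holds`) and `local_conclusions_of_eq_bot`
  (`InseparableLocalUniformizationHeightZero.lean`). Since the trivial valuation is Abhyankar
  (`transcendenceDefect_top`), this is the height-`0` part of `Temkin2013DescentAbhyankar`, and
  it certifies that the conclusion `Temkin2013DescentFor` is satisfiable.
* PROVED: `xadic_height_one_abhyankar` — the HYPOTHESES of `Temkin2013DescentAbhyankar` are met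
  in height one: for every field `k`, `k(X)/k` is finitely generated and the `X`-adic valuation
  ring of `k(X)` contains `k`, is not the whole field, has height `≤ 1`, rational rank `≥ 1`
  and transcendence defect `0`.

## Sources

* M. Temkin, *Inseparable local uniformization*, J. Algebra 373 (2013) 65–119 =
  arXiv:0804.1554v3: §2.1 (pp. 9–10: `E`, `F`, `D`, Abhyankar extensions, Remark 2.1.2),
  Thm. 4.1.1, Remarks 4.1.2/4.1.3 and the proof of Thm. 4.1.1, Steps 0–4 (pp. 47–50), §5
  (p. 51) and Thm. 5.5.2 (p. 60).

## Rendering notes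

* As in the companion files: `k` trivially valued ↦ `hk : ∀ c : k, algebraMap k K c ∈ O`;
  height `≤ 1` ↦ `ringKrullDim O ≤ 1`; `D_{K/k}` ↦ `transcendenceDefect k O hk : ℕ`
  (`TranscendenceDefect.lean`; the printed `D` because `K/k` is finitely generated,
  `transcendenceDefect_add_eq`).
* The two named facts are CONSEQUENCES of the printed Thm. 4.1.1 (`Temkin2013Descent.abhyankar`,
  `Temkin2013Descent.defectStep`), vendored separately because the paper proves them by
  different means (§5 resp. §§2–3) and by its own account (Step 0).
-/

noncomputable section

open IsLocalRing

namespace Literature.AlgebraicGeometry.Resolution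

universe u

/-! ### The body of the descent theorem for one valued field -/

/-- The assertion of Temkin's descent theorem (Thm. 4.1.1 with `n = 1`, logarithmic data
dropped; see `Temkin2013Descent`) for ONE valued field `(K, O = K°)` over the trivially valued
ground field `k`: for every normal affine model `X = Spec A` of `K°` and every finite extension
of valued fields `(K₁, K₁°)/(K, K°)` there are `L₁ = LK₁ ⊇ L ⊇ l` (`l/k`, `L/lK` finite purely
inseparable), an affine refinement `X' = Spec A'` of `X` and the valuation ring `L₁°` over `K₁°`
whose centre on `Nr_{L₁}(X')` is a simple `l`-smooth (regular) point — verbatim the conclusion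
of `Temkin2013Descent`, so that `Temkin2013Descent` is this assertion for all finitely
generated `K/k` and all `O ⊇ k` of height `≤ 1` (`temkin2013Descent_iff`).
[cite: Temkin2013, Thm. 4.1.1] -/
def Temkin2013DescentFor (k K : Type u) [Field k] [Field K] [Algebra k K]
    (O : ValuationSubring K) : Prop :=
  ∀ A : Subalgebra k K, A.toSubring ≤ O.toSubring → A.FG → IsFractionRing A K →
    (∀ x : K, IsIntegral A x → x ∈ A) →
  ∀ (K₁ : Type u) [Field K₁] [Algebra K K₁], FiniteDimensional K K₁ →
  ∀ O₁ : ValuationSubring K₁, O₁.comap (algebraMap K K₁) = O →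
    ∃ (L₁ : Type u) (_ : Field L₁) (_ : Algebra K₁ L₁) (_ : Algebra K L₁) (_ : Algebra k L₁)
      (_ : IsScalarTower K K₁ L₁) (_ : IsScalarTower k K L₁),
      FiniteDimensional K₁ L₁ ∧ IsPurelyInseparable K₁ L₁ ∧
      ∃ l : IntermediateField k L₁, FiniteDimensional k l ∧ IsPurelyInseparable k l ∧
      ∃ L : IntermediateField K L₁, (l : Set L₁) ⊆ (L : Set L₁) ∧ IsPurelyInseparable K L ∧
        Algebra.adjoin K₁ (L : Set L₁) = ⊤ ∧
      ∃ (A' : Subalgebra k K), A ≤ A' ∧ A'.toSubring ≤ O.toSubring ∧ A'.FG ∧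
        IsFractionRing A' K ∧
      ∃ O₁' : ValuationSubring L₁, O₁'.comap (algebraMap K₁ L₁) = O₁ ∧
      ∃ (N : Subalgebra l L₁) (hN : N.toSubring ≤ O₁'.toSubring),
        (N : Set L₁) = {x : L₁ | IsIntegral (A'.map (IsScalarTower.toAlgHom k K L₁)) x} ∧
        (N.restrictScalars k).FG ∧ IsFractionRing N L₁ ∧
        Algebra.IsSmoothAt l (centreIdeal N O₁' hN) ∧
        Algebra.FormallySmooth l
          (IsLocalRing.ResidueField (Localization.AtPrime (centreIdeal N O₁' hN))) ∧
        IsRegularLocalRing (Localization.AtPrime (centreIdeal N O₁' hN))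

/-- `Temkin2013Descent` is, by definition, `Temkin2013DescentFor` for all finitely generated
`K/k` and all valuation rings `O ⊇ k` of `K` of height `≤ 1`. [folklore] -/
theorem temkin2013Descent_iff :
    Temkin2013Descent.{u} ↔
      ∀ (k K : Type u) [Field k] [Field K] [Algebra k K], (⊤ : IntermediateField k K).FG →
        ∀ O : ValuationSubring K, (∀ c : k, algebraMap k K c ∈ O) → ringKrullDim O ≤ 1 →
          Temkin2013DescentFor k K O :=
  Iff.rfl

/-! ### The filtration by the transcendence defect and the two printed ingredients -/

/-- **Thm. 4.1.1 (`n = 1`, non-logarithmic form) for valued fields of transcendence defect at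
most `d`**: `Temkin2013DescentFor k K O` for all finitely generated `K/k` and all valuation
rings `O ⊇ k` of `K` of height `≤ 1` with `D_{K/k} ≤ d` (`transcendenceDefect`,
`TranscendenceDefect.lean`; Temkin 2013, proof of Thm. 4.1.1, Step 0, p. 47: "Our proof runs by
induction on the transcendence defect `D_{K/k}` of `K` over `k`"). The filtration exhausts
`Temkin2013Descent` (`Temkin2013Descent.of_defect`). [cite: Temkin2013, Thm. 4.1.1 and Step 0 of its proof (p. 47)] -/
def Temkin2013DescentDefectLE (d : ℕ) : Prop :=
  ∀ (k K : Type u) [Field k] [Field K] [Algebra k K], (⊤ : IntermediateField k K).FG →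
    ∀ O : ValuationSubring K, (hk : ∀ c : k, algebraMap k K c ∈ O) → ringKrullDim O ≤ 1 →
      transcendenceDefect k O hk ≤ d → Temkin2013DescentFor k K O

/-- NAMED FACT — **the base of Temkin's induction on the transcendence defect: descent
inseparable local uniformization of Abhyankar valuations** (Temkin 2013, proof of Thm. 4.1.1,
Step 0, p. 47: "Our proof runs by induction on the transcendence defect `D_{K/k}` of `K` over
`k`. The induction base `D_{K/k} = 0` corresponds to the case of Abhyankar valuations, which
will be established in §5: it is a particular case of Theorem 5.5.2"; §5, p. 51: "To finish
the proof of Theorems 1.3.2 and 4.1.1 we have yet to prove Theorem 4.1.1 for Abhyankar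
valuations"; Thm. 5.5.2, pp. 59–60: "Assume that `k` is a trivially valued field, `K` is a
finitely generated Abhyankar valued `k`-field, `X` is an affine `k`-model of `K°`, `x ∈ X` is
the center of `K°`, and `K₁/K, …, K_n/K` are finite extensions of valued fields. … given a
finite purely inseparable extension `l/k` we provide each field `Lᵢ = lKᵢ` with the valuation
extending that of `Kᵢ`, set `Xᵢ = Nr_{Lᵢ}(X')`, and define `xᵢ ∈ Xᵢ` as the center of `Lᵢ°`
on `Xᵢ`. … (i) There exists a finite purely inseparable extension `l/k`, an affine refinement
`X' → X` and a Q-Cartier divisor `E' ⊂ X'` such that the pairs `(Xᵢ, Eᵢ)` and `(X', E')` are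
log smooth at `xᵢ` and `x'`, respectively, and each projection `fᵢ` is Kummer at `xᵢ`. In
addition, one can achieve that `x₁` is a simple `l`-smooth point and all `xᵢ`'s are of
simplicial shape"). Vendored as: Thm. 4.1.1 in the case `n = 1` and without the logarithmic
data (exactly the assertion `Temkin2013DescentFor` of `Temkin2013Descent`, with `L = lK`,
`L₁ = lK₁`) for finitely generated `K/k`, `k` trivially valued (`k ⊆ O`), `O = K°` of height
`≤ 1` and transcendence defect `D_{K/k} = 0` (`transcendenceDefect k O hk = 0`, i.e.
`E_{K/k} + F_{K/k} = tr.deg._k(K)`, `transcendenceDefect_eq_zero_iff`; "Abhyankar" = admits an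
Abhyankar transcendence basis, which for finite `tr.deg._k(K)` is `D = 0`, §2.1 p. 10) — a
consequence of the printed Thm. 4.1.1, and of Thm. 5.5.2 (i) (which has no height
restriction) via Step 0. The height-`0` part (trivial valuation, `D = 0` by
`transcendenceDefect_top`) is PROVED below (`temkin2013DescentFor_top`). Users take
`(h : Temkin2013DescentAbhyankar)`.
[cite: Temkin2013, Thm. 4.1.1, proof, Step 0 (p. 47) and Thm. 5.5.2 (i) (p. 60)] -/
def Temkin2013DescentAbhyankar : Prop :=
  ∀ (k K : Type u) [Field k] [Field K] [Algebra k K], (⊤ : IntermediateField k K).FG →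
    ∀ O : ValuationSubring K, (hk : ∀ c : k, algebraMap k K c ∈ O) → ringKrullDim O ≤ 1 →
      transcendenceDefect k O hk = 0 → Temkin2013DescentFor k K O

/-- NAMED FACT — **the step of Temkin's induction on the transcendence defect** (Temkin 2013,
proof of Thm. 4.1.1, pp. 47–50: Step 0 "we assume that `D = D_{K/k} > 0` and the theorem is
proved for smaller `D`'s"; Step 1 "Fiber `X` by curves and apply Theorem 3.3.1. Since
`D_{K/k} > 0`, it follows from Remark 2.1.2 that there exists a valued subfield `k̄ ↪ K`
containing `k` and such that `tr.deg._{k̄}(K) = 1` and `K/k̄` is transcendentally immediate; in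
particular, `D_{k̄/k} = D - 1`"; Step 2 "Refine `X` and `Y` and extend `K` …"; Step 3 "Refine
`Y` … so that `x_i` and `y_i` become smooth-equivalent" (Prop. 2.3.8, Lemma 2.8.4); Step 4
"Smoothen the points `y_i` by an additional refining of `Y` and a purely inseparable extension
of `k`. … Since `D_{k̄/k} = D - 1`, the induction assumption applies to the scheme `Y` and the
extensions `m_i/k̄` of valued fields" (Lemma 2.8.5), ending with "`x₁` is `l`-smooth, and,
replacing `l` with a purely inseparable extension, we can also arrange that `x₁` is a simple
`l`-smooth point"). Rendered, for the case `n = 1` without logarithmic data (whose Step 4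
invokes the induction hypothesis only in that same form, for `Y`, `k̄°` and the ONE extension
`m₁/k̄` — the descent form, Remark 4.1.3), as the implication these steps prove: Thm. 4.1.1
(`n = 1`, non-log) for all valued fields of transcendence defect `≤ d` implies it for those of
transcendence defect `≤ d + 1`. This packages the paper's Thm. 3.3.1 (uniformization of
`K₁, …, K_n` on a curve over `k̄°`, p. 44, resting on the Berkovich-analytic Thm. 3.2.6 and the
stable modification theorem), Prop. 2.3.8 and Lemmas 2.8.4/2.8.5 (smooth-equivalence), which
involve notions absent from Mathlib. Users take `(h : Temkin2013DescentDefectStep)`.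
[cite: Temkin2013, Thm. 4.1.1, proof, Steps 1–4 (arXiv:0804.1554v3 pp. 47–50)] -/
def Temkin2013DescentDefectStep : Prop :=
  ∀ d : ℕ, Temkin2013DescentDefectLE.{u} d → Temkin2013DescentDefectLE.{u} (d + 1)

/-! ### API: the facts are consequences of the theorem they decompose -/

/-- `Temkin2013DescentAbhyankar` is `Temkin2013DescentDefectLE 0`. [folklore] -/
theorem temkin2013DescentAbhyankar_iff :
    Temkin2013DescentAbhyankar.{u} ↔ Temkin2013DescentDefectLE.{u} 0 := by
  constructor
  · intro h k K _ _ _ hfg O hk hdim hD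
    exact h k K hfg O hk hdim (Nat.le_zero.mp hD)
  · intro h k K _ _ _ hfg O hk hdim hD
    exact h k K hfg O hk hdim hD.le

/-- The filtration is monotone. [folklore] -/
theorem Temkin2013DescentDefectLE.mono {d d' : ℕ} (hdd : d ≤ d')
    (h : Temkin2013DescentDefectLE.{u} d') : Temkin2013DescentDefectLE.{u} d :=
  fun k K _ _ _ hfg O hk hdim hD => h k K hfg O hk hdim (hD.trans hdd)

/-- The descent theorem gives every level of the filtration. [folklore] -/
theorem Temkin2013Descent.defectLE (h : Temkin2013Descent.{u}) (d : ℕ) :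
    Temkin2013DescentDefectLE.{u} d :=
  fun k K _ _ _ hfg O hk hdim _ => h k K hfg O hk hdim

/-- Sanity check on strength: the descent theorem implies the base fact. [folklore] -/
theorem Temkin2013Descent.abhyankar (h : Temkin2013Descent.{u}) :
    Temkin2013DescentAbhyankar.{u} :=
  temkin2013DescentAbhyankar_iff.mpr (h.defectLE 0)

/-- Sanity check on strength: the descent theorem implies the step fact. [folklore] -/
theorem Temkin2013Descent.defectStep (h : Temkin2013Descent.{u}) :
    Temkin2013DescentDefectStep.{u} :=
  fun d _ => h.defectLE (d + 1)

/-! ### Assembly: Thm. 4.1.1 (`n = 1`) by induction on the transcendence defect -/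

/-- **Induction on the transcendence defect** (Temkin 2013, proof of Thm. 4.1.1, Step 0,
p. 47): base and step give every level of the filtration. [cite: Temkin2013, Thm. 4.1.1, proof, Step 0 (p. 47)] -/
theorem Temkin2013DescentDefectLE.of_step (h0 : Temkin2013DescentAbhyankar.{u})
    (hs : Temkin2013DescentDefectStep.{u}) (d : ℕ) : Temkin2013DescentDefectLE.{u} d := by
  induction d with
  | zero => exact temkin2013DescentAbhyankar_iff.mp h0
  | succ d ih => exact hs d ih

/-- **Thm. 4.1.1 (`n = 1`, non-logarithmic form) from the two printed ingredients of its
proof**: the Abhyankar case (Step 0 ⇐ Thm. 5.5.2) and the induction step (Steps 1–4). Every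
finitely generated valued `K/k` has SOME finite transcendence defect, so the filtration
`Temkin2013DescentDefectLE` exhausts `Temkin2013Descent`. [cite: Temkin2013, Thm. 4.1.1, proof (pp. 47–50)] -/
theorem Temkin2013Descent.of_defect (h0 : Temkin2013DescentAbhyankar.{u})
    (hs : Temkin2013DescentDefectStep.{u}) : Temkin2013Descent.{u} :=
  fun k K _ _ _ hfg O hk hdim =>
    Temkin2013DescentDefectLE.of_step h0 hs (transcendenceDefect k O hk) k K hfg O hk hdim le_rfl

/-- Modulo the Abhyankar case, the descent theorem is EQUIVALENT to the induction step.
[folklore] -/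
theorem temkin2013Descent_iff_defectStep (h0 : Temkin2013DescentAbhyankar.{u}) :
    Temkin2013Descent.{u} ↔ Temkin2013DescentDefectStep.{u} :=
  ⟨Temkin2013Descent.defectStep, Temkin2013Descent.of_defect h0⟩

/-- **New frontier of Temkin's Thm. 1.3.2.** The corrected relative theorem
`Temkin2013Relative` follows from: the Abhyankar case of Thm. 4.1.1 (`n = 1`; Step 0 ⇐
Thm. 5.5.2), the induction step on the transcendence defect (Thm. 4.1.1, Steps 1–4), and the
induction step on the height (§4.2) — three results of the paper by their own numbers; all
elementary inputs (finiteness of height and of the transcendence defect, Abhyankar's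
inequality, E. Noether's finiteness of integral closure, the height-`0` case) are proved.
[cite: Temkin2013, Section 4] -/
theorem Temkin2013Relative.of_defect_frontier (h0 : Temkin2013DescentAbhyankar.{u})
    (hs : Temkin2013DescentDefectStep.{u}) (hh : Temkin2013HeightStepOfDescent.{u}) :
    Temkin2013Relative.{u} :=
  Temkin2013Relative.of_descent (Temkin2013Descent.of_defect h0 hs)
    NoetherFiniteIntegralClosure_holds hh

/-- … and hence the weak absolute form `Temkin2013` used by the routes.
[cite: Temkin2013, Thm. 1.3.2] -/
theorem Temkin2013.of_defect_frontier (h0 : Temkin2013DescentAbhyankar.{u})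
    (hs : Temkin2013DescentDefectStep.{u}) (hh : Temkin2013HeightStepOfDescent.{u}) :
    Temkin2013.{u} :=
  (Temkin2013Relative.of_defect_frontier h0 hs hh).temkin2013

/-- The height-`≤ 1` case from the new frontier. [folklore] -/
theorem Temkin2013HeightLeOne.of_defect_frontier (h0 : Temkin2013DescentAbhyankar.{u})
    (hs : Temkin2013DescentDefectStep.{u}) : Temkin2013HeightLeOne.{u} :=
  (Temkin2013Descent.of_defect h0 hs).heightLeOne NoetherFiniteIntegralClosure_holds

/-! ### Height zero of the descent theorem, unconditionally -/

/-- **Normalisation of an affine model in a finite extension, at the generic point.** For an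
affine model `X = Spec A` of `K/k` (`A` finitely generated, `Frac A = K`), a finite extension
`L₁/K` and `l ≤ L₁` finite over `k` with `L₁` formally smooth over `l`: `N = Nr_{L₁}(A)` (the
integral closure of `A` in `L₁`, an `l`-subalgebra, finitely generated over `k` by E. Noether's
finiteness theorem `NoetherFiniteIntegralClosure_holds`, `Frac N = L₁`), and the centre of the
trivial valuation ring `L₁° = L₁` on `Spec N` is the generic point, at which `Spec N` is
`l`-smooth, simple and regular (the local ring is the field `L₁`; `local_conclusions_of_eq_bot`).
[folklore] -/
theorem exists_normalisation_top (k K : Type u) [Field k] [Field K] [Algebra k K]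
    (A : Subalgebra k K) (hAfg : A.FG) (hAfr : IsFractionRing A K)
    (L₁ : Type u) [Field L₁] [Algebra K L₁] [Algebra k L₁] [IsScalarTower k K L₁]
    [FiniteDimensional K L₁] (l : IntermediateField k L₁) [FiniteDimensional k l]
    [Algebra.FormallySmooth l L₁] :
    ∃ (N : Subalgebra l L₁) (hN : N.toSubring ≤ (⊤ : ValuationSubring L₁).toSubring),
      (N : Set L₁) = {x : L₁ | IsIntegral (A.map (IsScalarTower.toAlgHom k K L₁)) x} ∧
      (N.restrictScalars k).FG ∧ IsFractionRing N L₁ ∧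
      Algebra.IsSmoothAt l (centreIdeal N ⊤ hN) ∧
      Algebra.FormallySmooth l
        (IsLocalRing.ResidueField (Localization.AtPrime (centreIdeal N ⊤ hN))) ∧
      IsRegularLocalRing (Localization.AtPrime (centreIdeal N ⊤ hN)) := by
  classical
  haveI : IsFractionRing A K := hAfr
  haveI : Algebra.FiniteType k A := (Subalgebra.fg_iff_finiteType A).mp hAfg
  -- the integral closure of `A` in `L₁`, finite over `A` (E. Noether)
  haveI hNint : Module.Finite A (integralClosure A L₁) := NoetherFiniteIntegralClosure_holds k A K L₁
  have hft : Algebra.FiniteType k (integralClosure A L₁) :=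
    Algebra.FiniteType.trans (S := A) inferInstance inferInstance
  -- elements of `l` are integral over `k ⊆ A`
  have hlint : ∀ c : l, IsIntegral A (algebraMap l L₁ c) := fun c => by
    have h1 : IsIntegral k c := Algebra.IsIntegral.isIntegral c
    exact (h1.map (IsScalarTower.toAlgHom k l L₁)).tower_top
  let N : Subalgebra l L₁ :=
    { carrier := {x : L₁ | IsIntegral A x}
      mul_mem' := fun ha hb => ha.mul hb
      one_mem' := isIntegral_one
      add_mem' := fun ha hb => ha.add hb
      zero_mem' := isIntegral_zero
      algebraMap_mem' := hlint }
  have hNtop : N.toSubring ≤ (⊤ : ValuationSubring L₁).toSubring := fun _ _ =>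
    ValuationSubring.mem_top _
  -- the carrier is the integral closure of the image of `A`
  let φ : K →ₐ[k] L₁ := IsScalarTower.toAlgHom k K L₁
  have hcarrier : (N : Set L₁) = {x : L₁ | IsIntegral (A.map φ) x} := by
    let e : A ≃ₐ[k] A.map φ := Subalgebra.equivMapOfInjective A φ (algebraMap K L₁).injective
    have hcomp : (algebraMap (A.map φ) L₁).comp (e : A →+* A.map φ) =
        (RingHom.id L₁).comp (algebraMap A L₁) := RingHom.ext fun _ => rfl
    have hcomp' : (algebraMap A L₁).comp (e.symm : A.map φ →+* A) =
        (RingHom.id L₁).comp (algebraMap (A.map φ) L₁) := by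
      refine RingHom.ext fun x => ?_
      obtain ⟨y, rfl⟩ := e.surjective x
      simp only [RingHom.coe_comp, RingHom.coe_coe, Function.comp_apply, AlgEquiv.symm_apply_apply,
        RingHom.id_apply]
      exact (congrArg (fun g : A →+* L₁ => g y) hcomp).symm
    ext x
    exact ⟨fun hx => IsIntegral.map_of_comp_eq (e : A →+* A.map φ) (RingHom.id L₁) hcomp hx,
      fun hx => IsIntegral.map_of_comp_eq (e.symm : A.map φ →+* A) (RingHom.id L₁) hcomp' hx⟩
  -- `N` is finitely generated over `k`
  have hNfg : (N.restrictScalars k).FG := by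
    rw [Subalgebra.fg_iff_finiteType]
    let e : integralClosure A L₁ ≃ₐ[k] N.restrictScalars k :=
      { toFun := fun x => ⟨x.1, x.2⟩
        invFun := fun x => ⟨x.1, x.2⟩
        left_inv := fun _ => rfl
        right_inv := fun _ => rfl
        map_mul' := fun _ _ => rfl
        map_add' := fun _ _ => rfl
        commutes' := fun _ => rfl }
    exact hft.equiv e
  -- `Frac N = L₁`
  haveI hNfr : IsFractionRing N L₁ := by
    refine IsFractionRing.of_field N L₁ fun z => ?_
    haveI : Algebra.IsAlgebraic K L₁ := Algebra.IsAlgebraic.of_finite K L₁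
    have hz : IsAlgebraic A z :=
      (IsFractionRing.isAlgebraic_iff A K L₁).mpr (Algebra.IsAlgebraic.isAlgebraic z)
    obtain ⟨a, ha0, hint⟩ := hz.exists_integral_multiple
    refine ⟨⟨a • z, hint⟩, ⟨algebraMap A L₁ a, isIntegral_algebraMap⟩, ?_⟩
    have ha' : (algebraMap A L₁ a) ≠ 0 :=
      (map_ne_zero_iff _ (FaithfulSMul.algebraMap_injective A L₁)).mpr ha0
    change z = (a • z) / algebraMap A L₁ a
    rw [Algebra.smul_def, eq_div_iff ha', mul_comm]
  -- the centre is the generic point; conclude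
  have hcen : centreIdeal N ⊤ hNtop = ⊥ := centreIdeal_top_eq_bot N hNtop
  obtain ⟨h1, h2, h3⟩ := local_conclusions_of_eq_bot N (centreIdeal N ⊤ hNtop) hcen
  exact ⟨N, hNtop, hcarrier, hNfg, hNfr, h1, h2, h3⟩

/-- **Temkin's descent theorem (Thm. 4.1.1, `n = 1`) in height `0`**, PROVED unconditionally:
for `K/k` finitely generated with the TRIVIAL valuation `K° = K` (so that every finite
extension `K₁/K` of valued fields is trivially valued too, `K₁°` being integrally closed), any
normal affine model `X = Spec A` and any finite `K₁/K`: by the classical theorem on separating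
transcendence bases (`exists_purelyInseparable_isSeparablyGenerated`, applied to the finitely
generated `K₁/k`) there is a finite purely inseparable `l/k` with `L₁ = lK₁` separably
generated, hence formally smooth, over `l`; with `L = lK` (purely inseparable over `K`,
`LK₁ = L₁`), `X' = X` and `Nr_{L₁}(X) = Spec N` (`exists_normalisation_top`) the centre of
`L₁° = L₁` is the generic point, a simple `l`-smooth regular point. This is the sentence "the
case of valued fields of height zero reduces to the classical theorem on the existence of a
separating transcendence basis" (proof of Thm. 4.1.1, p. 47) for the descent form, and — the
trivial valuation being Abhyankar, `transcendenceDefect_top` — the height-`0` part of the named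
fact `Temkin2013DescentAbhyankar`; it certifies that the conclusion `Temkin2013DescentFor` is
satisfiable. [cite: Temkin2013, Thm. 4.1.1, proof, first sentence (p. 47)] -/
theorem temkin2013DescentFor_top (k K : Type u) [Field k] [Field K] [Algebra k K]
    (hfg : (⊤ : IntermediateField k K).FG) : Temkin2013DescentFor k K ⊤ := by
  intro A hAO hAfg hAfr _ K₁ _ _ hfin O₁ hO₁
  classical
  haveI := hfin
  -- `k` acts on `K₁` through `K`
  letI : Algebra k K₁ := ((algebraMap K K₁).comp (algebraMap k K)).toAlgebra
  haveI : IsScalarTower k K K₁ := IsScalarTower.of_algebraMap_eq fun _ => rfl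
  -- `K₁° = K₁`: it contains `K` and is integrally closed in the finite extension `K₁/K`
  have hO₁top : O₁ = ⊤ := by
    haveI : Algebra.IsIntegral K K₁ := Algebra.IsIntegral.of_finite K K₁
    have hbot : (⊥ : Subalgebra K K₁).toSubring ≤ O₁.toSubring := by
      intro x hx
      obtain ⟨y, rfl⟩ := Algebra.mem_bot.mp hx
      have hy : y ∈ O₁.comap (algebraMap K K₁) := by
        rw [hO₁]
        exact ValuationSubring.mem_top y
      exact hy
    ext x
    exact ⟨fun _ => ValuationSubring.mem_top x, fun _ =>
      mem_valuationSubring_of_isIntegral O₁ (⊥ : Subalgebra K K₁) hbot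
        (Algebra.IsIntegral.isIntegral (R := K) x).tower_top⟩
  subst hO₁top
  -- `K₁/k` is finitely generated
  have hfg₁ : (⊤ : IntermediateField k K₁).FG := by
    haveI : Algebra.EssFiniteType k K := IntermediateField.fg_top_iff.mp hfg
    haveI : Algebra.EssFiniteType K K₁ := inferInstance
    exact IntermediateField.fg_top_iff.mpr (Algebra.EssFiniteType.comp k K K₁)
  -- separating transcendence basis after a purely inseparable extension of the constants
  obtain ⟨L₁, _, _, _, _, hfin₁, hpi₁, l, hlfin, hlpi, hlK₁, -, hsmooth⟩ :=
    exists_purelyInseparable_isSeparablyGenerated k K₁ hfg₁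
  haveI := hfin₁
  haveI := hpi₁
  haveI := hlfin
  haveI := hlpi
  haveI := hsmooth
  letI : Algebra K L₁ := ((algebraMap K₁ L₁).comp (algebraMap K K₁)).toAlgebra
  haveI : IsScalarTower K K₁ L₁ := IsScalarTower.of_algebraMap_eq fun _ => rfl
  haveI : IsScalarTower k K L₁ := IsScalarTower.of_algebraMap_eq fun c => by
    show algebraMap k L₁ c = algebraMap K₁ L₁ (algebraMap K K₁ (algebraMap k K c))
    rw [← IsScalarTower.algebraMap_apply k K K₁, ← IsScalarTower.algebraMap_apply k K₁ L₁]
  haveI : FiniteDimensional K L₁ := Module.Finite.trans K₁ L₁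
  -- `L = lK`
  let L : IntermediateField K L₁ := IntermediateField.adjoin K (l : Set L₁)
  have hlL : (l : Set L₁) ⊆ (L : Set L₁) := IntermediateField.subset_adjoin K _
  have hLpi : IsPurelyInseparable K L := by
    obtain ⟨q, hq⟩ := ExpChar.exists k
    haveI : ExpChar K q := expChar_of_injective_algebraMap (algebraMap k K).injective q
    rw [IntermediateField.isPurelyInseparable_adjoin_iff_pow_mem K L₁ q]
    intro x hx
    obtain ⟨n, c, hc⟩ := IsPurelyInseparable.pow_mem k q (⟨x, hx⟩ : l)
    refine ⟨n, algebraMap k K c, ?_⟩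
    have h1 := congrArg (algebraMap l L₁) hc
    rw [← IsScalarTower.algebraMap_apply k l L₁, map_pow] at h1
    rw [← IsScalarTower.algebraMap_apply k K L₁]
    exact h1
  have hadj : Algebra.adjoin K₁ (L : Set L₁) = ⊤ := by
    have h1 : Algebra.adjoin K₁ (l : Set L₁) = ⊤ := by
      haveI : Algebra.IsAlgebraic K₁ L₁ := Algebra.IsAlgebraic.of_finite K₁ L₁
      have := congrArg IntermediateField.toSubalgebra hlK₁
      rwa [IntermediateField.adjoin_toSubalgebra_of_isAlgebraic
        (fun x _ => Algebra.IsAlgebraic.isAlgebraic x), IntermediateField.top_toSubalgebra] at this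
    exact eq_top_iff.mpr (h1 ▸ Algebra.adjoin_mono hlL)
  -- `Nr_{L₁}(X)` and the generic point
  obtain ⟨N, hN, hNint, hNfg, hNfr, h1, h2, h3⟩ := exists_normalisation_top k K A hAfg hAfr L₁ l
  have hcomap : (⊤ : ValuationSubring L₁).comap (algebraMap K₁ L₁) = ⊤ := by
    ext x
    simp [ValuationSubring.mem_comap, ValuationSubring.mem_top]
  exact ⟨L₁, inferInstance, inferInstance, inferInstance, inferInstance, inferInstance,
    inferInstance, hfin₁, hpi₁, l, hlfin, hlpi, L, hlL, hLpi, hadj, A, le_rfl, hAO, hAfg, hAfr,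
    ⊤, hcomap, N, hN, hNint, hNfg, hNfr, h1, h2, h3⟩

/-- Hence the base fact `Temkin2013DescentAbhyankar` HOLDS in height `0` (trivial valuation,
`ringKrullDim K° ≤ 0`), unconditionally. [folklore] -/
theorem temkin2013DescentFor_of_ringKrullDim_le_zero (k K : Type u) [Field k] [Field K]
    [Algebra k K] (hfg : (⊤ : IntermediateField k K).FG) (O : ValuationSubring K)
    (hdim : ringKrullDim O ≤ 0) : Temkin2013DescentFor k K O := by
  have hOtop : O = ⊤ := valuationSubring_eq_top_of_ringKrullDim_le_zero O hdim
  subst hOtop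
  exact temkin2013DescentFor_top k K hfg

/-! ### Non-vacuity: a height-one Abhyankar valued function field -/

section NonVacuity

open Polynomial IsDedekindDomain


variable (k : Type u) [Field k]

/-- The `X`-adic valuation ring of the rational function field `k(X)`. [folklore] -/
def xadicValuationSubring : ValuationSubring (RatFunc k) :=
  ((Polynomial.idealX k).valuation (RatFunc k)).valuationSubring

/-- `k(X) = k⟮X⟯`: the rational function field is generated by `X`. [folklore] -/
theorem ratFunc_adjoin_X_eq_top :
    IntermediateField.adjoin k ({RatFunc.X} : Set (RatFunc k)) = ⊤ := by
  rw [eq_top_iff]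
  intro u _
  have hmem : ∀ p : k[X], algebraMap k[X] (RatFunc k) p ∈
      IntermediateField.adjoin k ({RatFunc.X} : Set (RatFunc k)) := fun p => by
    rw [← RatFunc.aeval_X_left_eq_algebraMap]
    have h : Polynomial.aeval (RatFunc.X : RatFunc k) p ∈
        Algebra.adjoin k ({RatFunc.X} : Set (RatFunc k)) :=
      Polynomial.aeval_mem_adjoin_singleton k _
    exact IntermediateField.algebra_adjoin_le_adjoin k _ h
  rw [← RatFunc.num_div_denom u]
  exact div_mem (hmem _) (hmem _)

/-- `tr.deg._k k(X) ≤ 1`. [folklore] -/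
theorem trdeg_ratFunc_le_one : Algebra.trdeg k (RatFunc k) ≤ 1 := by
  haveI hal : Algebra.IsAlgebraic
      (IntermediateField.adjoin k ({RatFunc.X} : Set (RatFunc k))) (RatFunc k) := by
    rw [ratFunc_adjoin_X_eq_top k]
    exact ⟨fun x => isAlgebraic_algebraMap (⟨x, trivial⟩ : (⊤ : IntermediateField k (RatFunc k)))⟩
  haveI : Algebra.IsAlgebraic (Algebra.adjoin k ({RatFunc.X} : Set (RatFunc k))) (RatFunc k) :=
    IntermediateField.isAlgebraic_adjoin_iff_top.mp hal
  have h := Algebra.IsAlgebraic.trdeg_le_cardinalMk k ({RatFunc.X} : Set (RatFunc k))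
  simpa using h

/-- **A height-one Abhyankar valuation** (non-vacuity of the hypotheses of
`Temkin2013DescentAbhyankar` in height `1`): `k(X)/k` is finitely generated, and the `X`-adic
valuation ring `O` of `k(X)` contains `k`, is not the whole field, has height `≤ 1`, rational
rank `≥ 1` and transcendence defect `D = 0` (`E = N = 1`, `F = 0`). [folklore] -/
theorem xadic_height_one_abhyankar :
    ∃ hk : ∀ c : k, algebraMap k (RatFunc k) c ∈ xadicValuationSubring k,
      (⊤ : IntermediateField k (RatFunc k)).FG ∧
      xadicValuationSubring k ≠ ⊤ ∧ ringKrullDim (xadicValuationSubring k) ≤ 1 ∧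
      1 ≤ ratRank (xadicValuationSubring k) ∧
      transcendenceDefect k (xadicValuationSubring k) hk = 0 := by
  set O := xadicValuationSubring k with hO
  set v : Valuation (RatFunc k) (WithZero (Multiplicative ℤ)) :=
    (Polynomial.idealX k).valuation (RatFunc k) with hv
  have hmem : ∀ x : RatFunc k, x ∈ O ↔ v x ≤ 1 := fun x => Iff.rfl
  have hk : ∀ c : k, algebraMap k (RatFunc k) c ∈ O := fun c => by
    rw [hmem, IsScalarTower.algebraMap_apply k k[X] (RatFunc k)]
    exact HeightOneSpectrum.valuation_le_one _ _
  have hvX : v RatFunc.X = WithZero.exp (-1 : ℤ) := Polynomial.valuation_X_eq_neg_one k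
  have hXlt : v RatFunc.X < 1 := by
    rw [hvX, ← WithZero.exp_zero, WithZero.exp_lt_exp]
    norm_num
  have hXO : (RatFunc.X : RatFunc k) ∈ O := (hmem _).mpr hXlt.le
  have hX0 : v RatFunc.X ≠ 0 := (Valuation.ne_zero_iff v).mpr RatFunc.X_ne_zero
  have hXinv : (RatFunc.X : RatFunc k)⁻¹ ∉ O := by
    rw [hmem, map_inv₀, not_le]
    exact (one_lt_inv₀ (zero_lt_iff.mpr hX0)).mpr hXlt
  -- `E ≥ 1`: the value of `X` is a non-trivial element of the (torsion-free) value group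
  have hOX : O.valuation RatFunc.X < 1 :=
    (Valuation.isEquiv_valuation_valuationSubring v).lt_one_iff_lt_one.mp hXlt
  have hOX0 : O.valuation RatFunc.X ≠ 0 := valuation_ne_zero_of_ne_zero O RatFunc.X_ne_zero
  set u : (ValuationSubring.ValueGroup O)ˣ := Units.mk0 _ hOX0 with hu
  have hu1 : u < 1 := by
    rw [← Units.val_lt_val]
    simpa [hu] using hOX
  have hli : LinearIndependent ℤ (fun _ : PUnit.{u + 1} => Additive.ofMul u) := by
    rw [Fintype.linearIndependent_iff]
    intro g hg i
    have h1 : g PUnit.unit • Additive.ofMul u = 0 := by simpa using hg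
    have h2 : u ^ (g PUnit.unit) = 1 := by
      have := congrArg Additive.toMul h1
      simpa using this
    have h3 : u ^ (g PUnit.unit) = u ^ (0 : ℤ) := by rw [h2, zpow_zero]
    have h4 : g PUnit.unit = 0 := (zpow_right_strictAnti hu1).injective h3
    cases i
    exact h4
  have hE : (1 : Cardinal) ≤ ratRank O := by
    have := hli.cardinal_le_rank
    simpa [ratRank] using this
  have hN1 : Algebra.trdeg k (RatFunc k) ≤ 1 := trdeg_ratFunc_le_one k
  have hN : Algebra.trdeg k (RatFunc k) < Cardinal.aleph0 := hN1.trans_lt Cardinal.one_lt_aleph0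
  have hfg : (⊤ : IntermediateField k (RatFunc k)).FG :=
    ⟨{RatFunc.X}, by simpa using ratFunc_adjoin_X_eq_top k⟩
  refine ⟨hk, hfg, ?_, ?_, hE, ?_⟩
  · -- `O ≠ ⊤`
    intro htop
    exact hXinv (htop ▸ ValuationSubring.mem_top _)
  · -- height `≤ 1` (`≤ tr.deg`, `ringKrullDim_valuationSubring_le_trdeg`)
    obtain ⟨n, hn, hnle⟩ := ringKrullDim_valuationSubring_le_trdeg k (RatFunc k) hfg O hk
    have hn1 : n ≤ 1 := by exact_mod_cast hnle.trans hN1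
    exact hn.trans (by exact_mod_cast hn1)
  · -- `D = N - E - F = 0` since `N ≤ 1 ≤ E`
    unfold transcendenceDefect
    have h1 : Cardinal.toNat (Algebra.trdeg k (RatFunc k)) ≤ 1 := by
      have := Cardinal.toNat_le_toNat hN1 Cardinal.one_lt_aleph0
      simpa using this
    have h2 : 1 ≤ Cardinal.toNat (ratRank O) := by
      have := Cardinal.toNat_le_toNat hE (ratRank_lt_aleph0 O hk hN)
      simpa using this
    omega

end NonVacuity

end Literature.AlgebraicGeometry.Resolution
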